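import Summits.KontsevichZagierPeriods.Zeta5Search.Barrier.ConeGammaTranslateGradient

/-!
# ζ(5) search — BARRIER: GENERIC TRANSLATES HAVE A MARGIN — the hypotheses of the gradient / tilt theorems hold off
# countably many rational hyperplanes, with an explicit margin

HONEST FRAMING (cell `pub-zeta5`): systematic search; no irrationality claim unless kernel-certified. MODEL objects
under Brown–Zudilin's (28)+(30) accounting ([BZ22] = arXiv:2210.03391; (28) observed, not proved); nothing here is a
statement about `ζ(5)`, any `γ` of record, the cone's supremum (C2 OPEN) or any value at a named direction; S-E / (TD_A)
stay CONJECTURED; records in print UNMOVED. Prover P2 g40 (item «THE SIGNED JUMP MASSES», file (4); plan INBOX 2026-08-28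
l.9814).

Files (2b)/(3) (`ConeGammaTranslateGradient`, `ConeGammaTranslateTilt`) take the genericity of the translate `δ` as a
MARGIN `r > 0` with two finite families of inequalities (`hsep`: distinct crossings `r` apart; `hend`: no crossing within
`r` of `0`). This file shows those hypotheses are what «generic» should mean: with `N_k = T·h_k(a) ∈ ℤ` the crossing times
of the forms `k`, `k'` differ by `T·(z·N_{k'} − z'·N_k − C_{kk'})/(N_k N_{k'})`, `C_{kk'} = N_{k'}·φ_k(δ) − N_k·φ_{k'}(δ)`, so
* `exists_dist_int_pos` — a real off `ℤ` is at positive distance `min({c}, 1 − {c})` from every integer;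
* `crossing_sub_crossing` — the difference formula above;
* **`exists_margin_of_generic`** — if NO form value `φ_k(δ)` is an integer and NO resonance combination
  `N_{k'}·φ_k(δ) − N_k·φ_{k'}(δ)` (`k ≠ k'`) is an integer — countably many affine hyperplanes of `ℝ⁸` excluded, none of them
  all of `ℝ⁸` — then SOME `r > 0` satisfies both margin families, explicitly
  `r = min_k min(d_k/h_k, 1/h_k) ∧ min_{k≠k'} T·e_{kk'}/(N_k N_{k'})` (`d_k`, `e_{kk'}` the distances of `φ_kδ`, `C_{kk'}` to `ℤ`);
* **`translateIntegral_sub_eq_sum_jumpMass_of_generic`** — hence the GRADIENT THEOREM holds at every such `δ` for all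
  small `Δ` (with the margin produced here), i.e. `P` is affine near every translate off those hyperplanes;
* **`differentiableAt_translateIntegral`** — in Mathlib's calculus vocabulary: at every translate with a margin, `P` is
  (Fréchet) differentiable with `fderiv ℝ P δ Δ = Σ_k (φ_k(Δ)/h_k(a))·J_k(δ)` for every `Δ ∈ ℝ⁸` — THE SIGNED JUMP MASSES ARE
  THE DERIVATIVE OF THE TRANSLATE INTEGRAL (contrast the closed orbit `δ = 0`, where only the one-sided, degree-1 homogeneous
  cusp slope `σ` exists, P2 g19/g28);
* `translateIntegral_sub_eq_sum_jumpMass_near` — ONE affine chart on the whole ball: for base points `δ + Δ₀` and steps `Δ` with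
  `|φ_kΔ₀|, |φ_kΔ| ≤ r·h_k/8` the increment of `P` is `Σ_k (φ_k(Δ)/h_k)·J_k(δ)` with the jump masses AT `δ` — the derivative of `P`
  is locally constant on the generic set (the germ of «`P` affine on every cell», which a (TD_A) vertex certificate would cite).
NOT here (honest): measure-zero / residual bookkeeping of the excluded set (it is a countable union of hyperplanes by
inspection); anything at a named direction; `Φ`, `γ`, C2, S-E, `ζ(5)`.
-/

noncomputable section

open Set MeasureTheory
open scoped Topology

namespace Summit.KontsevichZagierPeriods.Zeta5Search.Barrier.ConeGamma

/-- **A real off the integers is at positive distance from them.** -/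
theorem exists_dist_int_pos {c : ℝ} (hc : ∀ z : ℤ, c ≠ z) : ∃ d : ℝ, 0 < d ∧ ∀ z : ℤ, d ≤ |c - z| := by
  refine ⟨min (c - ⌊c⌋) (⌊c⌋ + 1 - c), lt_min ?_ (by linarith [Int.lt_floor_add_one c]), fun z => ?_⟩
  · have h := Int.floor_le c
    exact lt_of_le_of_ne (by linarith) (fun h0 => hc ⌊c⌋ (by linarith))
  · rcases le_or_gt z ⌊c⌋ with hz | hz
    · have hz' : (z : ℝ) ≤ ⌊c⌋ := by exact_mod_cast hz
      rw [abs_of_nonneg (by linarith [Int.floor_le c])]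
      exact (min_le_left _ _).trans (by linarith)
    · have hz' : (⌊c⌋ : ℝ) + 1 ≤ z := by exact_mod_cast hz
      rw [abs_of_nonpos (by linarith [Int.lt_floor_add_one c])]
      exact (min_le_right _ _).trans (by linarith)

/-- **The difference of two crossing times.** With `T·h_k = N_k`, `T·h_{k'} = N_{k'}` (non-zero):
`(z − φ_kδ)/h_k − (z' − φ_{k'}δ)/h_{k'} = T·(z·N_{k'} − z'·N_k − (N_{k'}·φ_kδ − N_k·φ_{k'}δ))/(N_k·N_{k'})`. -/
theorem crossing_sub_crossing {a : Dir} (hpos : ∀ k, 0 < h28 a k) {T : ℝ} (hT : 0 < T) {δ : Fin 8 → ℝ}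
    {k k' : Fin 28} {N N' : ℤ} (hN : T * h28 a k = N) (hN' : T * h28 a k' = N') (z z' : ℤ) :
    ((z : ℝ) - phiForm δ k) / h28 a k - ((z' : ℝ) - phiForm δ k') / h28 a k' =
      T * ((z : ℝ) * N' - z' * N - ((N' : ℝ) * phiForm δ k - N * phiForm δ k')) / (N * N') := by
  have hx := hpos k; have hx' := hpos k'
  have hN0 : (N : ℝ) ≠ 0 := by rw [← hN]; positivity
  have hN0' : (N' : ℝ) ≠ 0 := by rw [← hN']; positivity
  rw [show h28 a k = N / T by rw [← hN]; field_simp, show h28 a k' = N' / T by rw [← hN']; field_simp]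
  field_simp
  ring

/-- **GENERIC TRANSLATES HAVE A MARGIN.** All 28 forms of `a` positive, `T > 0` a period (`T·h_k = N_k ∈ ℤ`). If the translate
`δ` has NO form value on a wall (`φ_k(δ) ∉ ℤ`) and NO resonance (`N_{k'}·φ_k(δ) − N_k·φ_{k'}(δ) ∉ ℤ` for `k ≠ k'`), then
there is a margin `r > 0` with: distinct crossings `(k,z) ≠ (k',z')` at least `r` apart, and every crossing time at least `r`
from `0` — the hypotheses `hsep`, `hend` of the gradient and tilt theorems. -/
theorem exists_margin_of_generic {a : Dir} (hpos : ∀ k, 0 < h28 a k) {T : ℝ} (hT : 0 < T)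
    (hper : ∀ k : Fin 28, ∃ z : ℤ, T * h28 a k = z) {δ : Fin 8 → ℝ}
    (hwall : ∀ (k : Fin 28) (z : ℤ), phiForm δ k ≠ z)
    (hres : ∀ (k k' : Fin 28), k ≠ k' → ∀ z : ℤ, T * h28 a k' * phiForm δ k - T * h28 a k * phiForm δ k' ≠ z) :
    ∃ r : ℝ, 0 < r ∧
      (∀ (k k' : Fin 28) (z z' : ℤ), (k ≠ k' ∨ z ≠ z') →
        r ≤ |((z : ℝ) - phiForm δ k) / h28 a k - ((z' : ℝ) - phiForm δ k') / h28 a k'|) ∧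
      (∀ (k : Fin 28) (z : ℤ), r ≤ |((z : ℝ) - phiForm δ k) / h28 a k|) := by
  choose N hN using hper
  have hNpos : ∀ k, (0 : ℝ) < N k := fun k => by rw [← hN k]; have := hpos k; positivity
  -- distances to the integers
  choose d hd hdz using fun k => exists_dist_int_pos (hwall k)
  have hres' : ∀ p : Fin 28 × Fin 28, p.1 ≠ p.2 → ∀ z : ℤ, (N p.2 : ℝ) * phiForm δ p.1 - N p.1 * phiForm δ p.2 ≠ z := by
    intro p hp z; rw [← hN p.2, ← hN p.1]; exact hres p.1 p.2 hp z
  -- pair margins (dummy `1` on the diagonal)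
  have hpair : ∀ p : Fin 28 × Fin 28, ∃ e : ℝ, 0 < e ∧ (p.1 ≠ p.2 →
      ∀ z : ℤ, e ≤ |(N p.2 : ℝ) * phiForm δ p.1 - N p.1 * phiForm δ p.2 - z|) := by
    intro p
    by_cases hp : p.1 = p.2
    · exact ⟨1, one_pos, fun h => absurd hp h⟩
    · obtain ⟨e, he, hez⟩ := exists_dist_int_pos (hres' p hp)
      exact ⟨e, he, fun _ => hez⟩
  choose e he hez using hpair
  set f : Fin 28 → ℝ := fun k => min (d k / h28 a k) (1 / h28 a k) with hf
  set g : Fin 28 × Fin 28 → ℝ := fun p => T * e p / ((N p.1 : ℝ) * N p.2) with hg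
  set r := min (Finset.univ.inf' Finset.univ_nonempty f) (Finset.univ.inf' Finset.univ_nonempty g) with hr
  have hfpos : ∀ k, 0 < f k := fun k => by have := hpos k; have := hd k; rw [hf]; positivity
  have hgpos : ∀ p, 0 < g p := fun p => by have := he p; have := hNpos p.1; have := hNpos p.2; rw [hg]; positivity
  have hrf : ∀ k, r ≤ f k := fun k => (min_le_left _ _).trans (Finset.inf'_le f (Finset.mem_univ k))
  have hrg : ∀ p, r ≤ g p := fun p => (min_le_right _ _).trans (Finset.inf'_le g (Finset.mem_univ p))
  refine ⟨r, lt_min ((Finset.lt_inf'_iff _).mpr fun k _ => hfpos k) ((Finset.lt_inf'_iff _).mpr fun p _ => hgpos p),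
    ?_, ?_⟩
  · intro k k' z z' hne
    have hx := hpos k; have hx' := hpos k'
    by_cases hkk : k = k'
    · -- same form: crossings `1/h_k` apart
      subst hkk
      have hzz : z ≠ z' := by tauto
      have h1 : (1 : ℝ) ≤ |((z : ℝ) - z')| := by
        rw [← Int.cast_sub, ← Int.cast_abs]; exact_mod_cast Int.one_le_abs (sub_ne_zero.mpr hzz)
      rw [show ((z : ℝ) - phiForm δ k) / h28 a k - ((z' : ℝ) - phiForm δ k) / h28 a k = ((z : ℝ) - z') / h28 a k by
        field_simp; ring, abs_div, abs_of_pos hx]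
      calc r ≤ f k := hrf k
        _ ≤ 1 / h28 a k := min_le_right _ _
        _ ≤ |(z : ℝ) - z'| / h28 a k := div_le_div_of_nonneg_right h1 hx.le
    · rw [crossing_sub_crossing hpos hT (hN k) (hN k') z z', abs_div, abs_mul, abs_of_pos hT,
        abs_of_pos (mul_pos (hNpos k) (hNpos k'))]
      have hint : ∃ w : ℤ, (z : ℝ) * N k' - z' * N k = w := ⟨z * N k' - z' * N k, by push_cast; ring⟩
      obtain ⟨w, hw⟩ := hint
      have hew := hez (k, k') hkk w
      simp only at hew
      have e1 : |(z : ℝ) * N k' - z' * N k - ((N k' : ℝ) * phiForm δ k - N k * phiForm δ k')| =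
          |(N k' : ℝ) * phiForm δ k - N k * phiForm δ k' - (w : ℝ)| := by
        rw [hw, abs_sub_comm]
      calc r ≤ g (k, k') := hrg (k, k')
        _ = T * e (k, k') / ((N k : ℝ) * N k') := rfl
        _ ≤ T * |(z : ℝ) * N k' - z' * N k - ((N k' : ℝ) * phiForm δ k - N k * phiForm δ k')| / ((N k : ℝ) * N k') := by
          rw [e1]
          exact div_le_div_of_nonneg_right (mul_le_mul_of_nonneg_left hew hT.le) (mul_pos (hNpos k) (hNpos k')).le
  · intro k z
    have hx := hpos k
    rw [abs_div, abs_of_pos hx, abs_sub_comm]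
    calc r ≤ f k := hrf k
      _ ≤ d k / h28 a k := min_le_left _ _
      _ ≤ |phiForm δ k - z| / h28 a k := div_le_div_of_nonneg_right (hdz k z) hx.le

/-- **THE GRADIENT THEOREM AT EVERY GENERIC TRANSLATE** (off the walls and the resonances): for such `δ` there are `r > 0`
such that `P(δ + Δ) − P(δ) = Σ_k (φ_k(Δ)/h_k(a))·J_k(δ)` for all `Δ` with `|φ_kΔ| ≤ r·h_k/4` — `P` is affine near `δ`. -/
theorem translateIntegral_sub_eq_sum_jumpMass_of_generic {a : Dir} (hpos : ∀ k, 0 < h28 a k) {T : ℝ} (hT : 0 < T)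
    (hper : ∀ k : Fin 28, ∃ z : ℤ, T * h28 a k = z) {δ : Fin 8 → ℝ}
    (hwall : ∀ (k : Fin 28) (z : ℤ), phiForm δ k ≠ z)
    (hres : ∀ (k k' : Fin 28), k ≠ k' → ∀ z : ℤ, T * h28 a k' * phiForm δ k - T * h28 a k * phiForm δ k' ≠ z) :
    ∃ r : ℝ, 0 < r ∧ ∀ Δ : Fin 8 → ℝ, (∀ k, |phiForm Δ k| ≤ r * h28 a k / 4) →
      translateIntegral a T (δ + Δ) - translateIntegral a T δ =
        ∑ k : Fin 28, phiForm Δ k / h28 a k *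
          ((∑ z ∈ Finset.Ioc ⌊phiForm δ k⌋ (⌊phiForm δ k⌋ + ⌊T * h28 a k⌋),
            (torusN ((((z : ℝ) - phiForm δ k) / h28 a k) • sParam a + δ) -
              torusN ((((z : ℝ) - phiForm δ k) / h28 a k - r / 2) • sParam a + δ)) : ℤ) : ℝ) := by
  obtain ⟨r, hr, hsep, hend⟩ := exists_margin_of_generic hpos hT hper hwall hres
  exact ⟨r, hr, fun Δ hΔ => translateIntegral_sub_eq_sum_jumpMass hpos hT hper hr hsep hend hΔ⟩


/-! ### In calculus vocabulary: `P` is differentiable at every generic translate, with derivative the jump masses -/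

/-- **THE SIGNED JUMP MASSES ARE THE DERIVATIVE OF THE TRANSLATE INTEGRAL** (Mathlib's `fderiv`): at a translate `δ` with
margin `r` (`hsep`, `hend`), `P = translateIntegral a T` is (Fréchet) differentiable and
`fderiv ℝ P δ Δ = Σ_k (φ_k(Δ)/h_k(a))·J_k(δ)` for EVERY `Δ ∈ ℝ⁸` (the sup-norm ball `‖Δ‖ < r·x_min/8` lies inside
`|φ_kΔ| ≤ r·h_k/4`, where `P` is exactly affine). -/
theorem differentiableAt_translateIntegral {a : Dir} (hpos : ∀ k, 0 < h28 a k) {T : ℝ} (hT : 0 < T)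
    (hper : ∀ k : Fin 28, ∃ z : ℤ, T * h28 a k = z) {δ : Fin 8 → ℝ} {r : ℝ} (hr : 0 < r)
    (hsep : ∀ (k k' : Fin 28) (z z' : ℤ), (k ≠ k' ∨ z ≠ z') →
      r ≤ |((z : ℝ) - phiForm δ k) / h28 a k - ((z' : ℝ) - phiForm δ k') / h28 a k'|)
    (hend : ∀ (k : Fin 28) (z : ℤ), r ≤ |((z : ℝ) - phiForm δ k) / h28 a k|) :
    DifferentiableAt ℝ (translateIntegral a T) δ ∧ ∀ Δ : Fin 8 → ℝ, fderiv ℝ (translateIntegral a T) δ Δ =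
      ∑ k : Fin 28, phiForm Δ k / h28 a k *
        ((∑ z ∈ Finset.Ioc ⌊phiForm δ k⌋ (⌊phiForm δ k⌋ + ⌊T * h28 a k⌋),
          (torusN ((((z : ℝ) - phiForm δ k) / h28 a k) • sParam a + δ) -
            torusN ((((z : ℝ) - phiForm δ k) / h28 a k - r / 2) • sParam a + δ)) : ℤ) : ℝ) := by
  -- the candidate derivative as a continuous linear map
  set J : Fin 28 → ℝ := fun k => ((∑ z ∈ Finset.Ioc ⌊phiForm δ k⌋ (⌊phiForm δ k⌋ + ⌊T * h28 a k⌋),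
    (torusN ((((z : ℝ) - phiForm δ k) / h28 a k) • sParam a + δ) -
      torusN ((((z : ℝ) - phiForm δ k) / h28 a k - r / 2) • sParam a + δ)) : ℤ) : ℝ) with hJ
  let Lₗ : (Fin 8 → ℝ) →ₗ[ℝ] ℝ :=
    { toFun := fun Δ => ∑ k : Fin 28, phiForm Δ k / h28 a k * J k
      map_add' := fun Δ Δ' => by
        rw [← Finset.sum_add_distrib]
        exact Finset.sum_congr rfl fun k _ => by rw [phiForm_add]; ring
      map_smul' := fun c Δ => by
        rw [RingHom.id_apply, smul_eq_mul, Finset.mul_sum]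
        exact Finset.sum_congr rfl fun k _ => by rw [phiForm_smul]; ring }
  set L : (Fin 8 → ℝ) →L[ℝ] ℝ := LinearMap.toContinuousLinearMap Lₗ with hL
  have hLapply : ∀ Δ, L Δ = ∑ k : Fin 28, phiForm Δ k / h28 a k * J k := fun Δ => rfl
  -- `P` is exactly affine on a sup-norm ball
  obtain ⟨m, hm, hmle⟩ : ∃ m : ℝ, 0 < m ∧ ∀ k, m ≤ h28 a k := by
    obtain ⟨k₀, -, hk₀⟩ := Finset.exists_min_image Finset.univ (fun k => h28 a k) Finset.univ_nonempty
    exact ⟨h28 a k₀, hpos k₀, fun k => hk₀ k (Finset.mem_univ k)⟩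
  have haff : ∀ᶠ Δ in 𝓝 (0 : Fin 8 → ℝ), translateIntegral a T (δ + Δ) - translateIntegral a T δ - L Δ = 0 := by
    rw [Metric.eventually_nhds_iff]
    refine ⟨r * m / 8, by positivity, fun Δ hΔ => ?_⟩
    rw [dist_zero_right] at hΔ
    have hsmall : ∀ k, |phiForm Δ k| ≤ r * h28 a k / 4 := fun k =>
      calc |phiForm Δ k| ≤ 2 * ‖Δ‖ := abs_phiForm_le_two_mul_norm Δ k
        _ ≤ r * h28 a k / 4 := by nlinarith [hmle k, hΔ.le]
    rw [hLapply, translateIntegral_sub_eq_sum_jumpMass hpos hT hper hr hsep hend hsmall, sub_self]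
  have hderiv : HasFDerivAt (translateIntegral a T) L δ := by
    rw [hasFDerivAt_iff_isLittleO_nhds_zero]
    exact (Asymptotics.isLittleO_zero (fun h : Fin 8 → ℝ => h) (𝓝 (0 : Fin 8 → ℝ))).congr'
      (haff.mono fun Δ h => h.symm) Filter.EventuallyEq.rfl
  exact ⟨hderiv.differentiableAt, fun Δ => by rw [hderiv.fderiv, hLapply]⟩


/-- **ONE AFFINE CHART ON THE WHOLE BALL.** With a margin `r` at `δ`, for every base point `δ + Δ₀` and step `Δ` with
`|φ_kΔ₀|, |φ_kΔ| ≤ r·h_k/8`: `P(δ + Δ₀ + Δ) − P(δ + Δ₀) = Σ_k (φ_k(Δ)/h_k(a))·J_k(δ)` — the SAME linear part (the jump masses AT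
`δ`) serves every point of the ball: the derivative of `P` is locally constant on the generic set (the germ of the statement
«`P` is affine on every cell of the translate arrangement» that a (TD_A) vertex certificate would cite). -/
theorem translateIntegral_sub_eq_sum_jumpMass_near {a : Dir} (hpos : ∀ k, 0 < h28 a k) {T : ℝ} (hT : 0 < T)
    (hper : ∀ k : Fin 28, ∃ z : ℤ, T * h28 a k = z) {δ : Fin 8 → ℝ} {r : ℝ} (hr : 0 < r)
    (hsep : ∀ (k k' : Fin 28) (z z' : ℤ), (k ≠ k' ∨ z ≠ z') →
      r ≤ |((z : ℝ) - phiForm δ k) / h28 a k - ((z' : ℝ) - phiForm δ k') / h28 a k'|)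
    (hend : ∀ (k : Fin 28) (z : ℤ), r ≤ |((z : ℝ) - phiForm δ k) / h28 a k|)
    {Δ₀ Δ : Fin 8 → ℝ} (hΔ₀ : ∀ k, |phiForm Δ₀ k| ≤ r * h28 a k / 8) (hΔ : ∀ k, |phiForm Δ k| ≤ r * h28 a k / 8) :
    translateIntegral a T (δ + Δ₀ + Δ) - translateIntegral a T (δ + Δ₀) =
      ∑ k : Fin 28, phiForm Δ k / h28 a k *
        ((∑ z ∈ Finset.Ioc ⌊phiForm δ k⌋ (⌊phiForm δ k⌋ + ⌊T * h28 a k⌋),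
          (torusN ((((z : ℝ) - phiForm δ k) / h28 a k) • sParam a + δ) -
            torusN ((((z : ℝ) - phiForm δ k) / h28 a k - r / 2) • sParam a + δ)) : ℤ) : ℝ) := by
  have h1 : ∀ k, |phiForm (Δ₀ + Δ) k| ≤ r * h28 a k / 4 := fun k => by
    rw [phiForm_add]; exact (abs_add_le _ _).trans (by linarith [hΔ₀ k, hΔ k])
  have h0 : ∀ k, |phiForm Δ₀ k| ≤ r * h28 a k / 4 := fun k => by have := hpos k; linarith [hΔ₀ k, abs_nonneg (phiForm Δ₀ k)]
  have e1 := translateIntegral_sub_eq_sum_jumpMass hpos hT hper hr hsep hend h1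
  have e0 := translateIntegral_sub_eq_sum_jumpMass hpos hT hper hr hsep hend h0
  rw [← add_assoc] at e1
  have e : translateIntegral a T (δ + Δ₀ + Δ) - translateIntegral a T (δ + Δ₀) =
      (translateIntegral a T (δ + Δ₀ + Δ) - translateIntegral a T δ) - (translateIntegral a T (δ + Δ₀) - translateIntegral a T δ) := by
    ring
  rw [e, e1, e0, ← Finset.sum_sub_distrib]
  refine Finset.sum_congr rfl fun k _ => ?_
  rw [phiForm_add]; ring

end Summit.KontsevichZagierPeriods.Zeta5Search.Barrier.ConeGamma

end
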